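import Summits.BirchSwinnertonDyer.BirchSwinnertonDyer.Theorems.SignedLowerHalvesSmallImageLowerHalfBothSignsLambdaLowerThreeNsThetaPartnerLevelMatchDet
import Literature.NumberTheory.EllipticCurves.CuspFormLFunctionLevelConductorCarayolProofs
import HarnessLib

/-!
# The Tate-module side of the level clause: a framed `ℚ̄_p`-model of `V_p(W)` with its Frobenius
# polynomials, conductor exponents and inertial determinant; `v_ℓ(N_W) = a_ℓ(V_p W)` (brick LM-G of
# `stub_levelMatch_ns`)

Route `SignedLowerHalves`, child L `SmallImageLowerHalfBothSigns` (item stmt-BirchSwinnertonDyer-23599), line `rtt_w3`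
(skeleton of record v2, stub `stub_levelMatch_ns`; width seat `bsd-line-slh-p3-w3` gen 10; memo
`Lines/birth_acns-MEMO-w3-g10.md` §4).  THEOREMS ONLY (no definition, no named fact, no `sorry`); ROUTE-INDEPENDENT and
MODULARITY-FREE (no newform of `W` is used).

* `exists_framedGaloisRep_padicAlgCl_tate` — for an elliptic `W/ℚ` and a prime `p` there is a framed continuous
  `ρ_W : Γ_ℚ →ₜ* GL₂(ℚ̄_p)` (the tree's framed `ℚ_p`-model of `V_p W`, `exists_framedGaloisRep_rationalTate`, base-changed
  along `ℚ_p → ℚ̄_p`) which (i) at every good place `v ∤ p` is unramified with Frobenius polynomial `X² - a_v(W) X + q_v`,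
  (ii) has the Artin conductor exponent `a_w(V_p W)` (`conductorExponentOf`) at every `w ∤ p`, (iii) has determinant
  `1` on every inertia group at `w ∤ p` (brick LM-E), and (iv) has the same kernel as `V_p W`.
* `padicValNat_conductorNorm_eq_conductorExponentOf` — `v_ℓ(N_W) = a_w(V_p W)` at the place `w ∋ ℓ`, `ℓ ≠ p`, granted
  Saito's half of Ogg's formula at the additive places over `2` (the registered cite input
  `swanConductorAt_rationalTate_eq_wildConductorExponent_of_ringChar_eq_two`; Ogg–Saito in Galois form is the tree's
  `artinConductorExponent_tate_eq_conductorExponent_of_isElliptic_of_two`, and `N_W = ∏ ℓ^{f_ℓ}` is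
  `factorization_conductorNorm_holds`).

BSD, crux L and the stub are NOT proved here.

References: J.-P. Serre, J. Tate, Good reduction of abelian varieties (1968) §§2–3; J. Silverman, ATAEC IV.10–11;
T. Saito (1988); folklore.
-/

set_option autoImplicit false
set_option linter.dupNamespace false

noncomputable section

open scoped MatrixGroups NumberField Polynomial
open Module Matrix NumberField IsDedekindDomain Field Polynomial Rat.HeightOneSpectrum WeierstrassCurve

namespace Summit.BirchSwinnertonDyer.BirchSwinnertonDyer.Theorems.SmallImageLambdaLowerThreeNsThetaPartner

open Literature.NumberTheory.GaloisRepresentations Literature.NumberTheory.EllipticCurves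
  Literature.NumberTheory.EllipticCurves.ModularForms

/-- Two distinct rational primes: if `ℓ ∈ w` then `p ∉ w` (`p ≠ ℓ`). [folklore] -/
theorem Rat.natCast_not_mem_of_ne {ℓ p : ℕ} (hℓ : ℓ.Prime) (hp : p.Prime) (hℓp : ℓ ≠ p)
    (w : HeightOneSpectrum (𝓞 ℚ)) (hℓw : (ℓ : 𝓞 ℚ) ∈ w.asIdeal) : (p : 𝓞 ℚ) ∉ w.asIdeal := by
  -- `m ∈ w ↔ p_w ∣ m` (the tree's `BigHeckeGLn.Rat.natCast_mem_asIdeal_iff_primesEquiv_dvd`, re-derived to keep imports light)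
  have hmem : ∀ m : ℕ, (m : 𝓞 ℚ) ∈ w.asIdeal ↔ natGenerator w ∣ m := fun m => by
    rw [natGenerator_dvd_iff, ← map_natCast (Rat.IsIntegralClosure.intEquiv (𝓞 ℚ)) m, Ideal.apply_mem_of_equiv_iff]
  have hq : natGenerator w = ℓ := (Nat.prime_dvd_prime_iff_eq (primesEquiv w).2 hℓ).mp ((hmem ℓ).mp hℓw)
  rw [hmem, hq]
  intro h
  exact hℓp ((Nat.prime_dvd_prime_iff_eq hℓ hp).mp h)

/-- The prime under the place `w ∋ ℓ` of `ℚ` is `ℓ`. [folklore] -/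
theorem Rat.natGenerator_eq_of_natCast_mem' {ℓ : ℕ} (hℓ : ℓ.Prime) (w : HeightOneSpectrum (𝓞 ℚ))
    (hℓw : (ℓ : 𝓞 ℚ) ∈ w.asIdeal) : natGenerator w = ℓ := by
  have hmem : (ℓ : 𝓞 ℚ) ∈ w.asIdeal ↔ natGenerator w ∣ ℓ := by
    rw [natGenerator_dvd_iff, ← map_natCast (Rat.IsIntegralClosure.intEquiv (𝓞 ℚ)) ℓ, Ideal.apply_mem_of_equiv_iff]
  exact (Nat.prime_dvd_prime_iff_eq (primesEquiv w).2 hℓ).mp (hmem.mp hℓw)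

/-- **`v_ℓ(N_W) = a_w(V_p W)`** at the place `w ∋ ℓ` of `ℚ`, `ℓ ≠ p`, granted Saito's half of Ogg's formula at the
additive places of residue characteristic `2` (Ogg–Saito in Galois form:
`artinConductorExponent_tate_eq_conductorExponent_of_isElliptic_of_two`; `N_W = ∏ ℓ^{f_ℓ}`:
`factorization_conductorNorm_holds`, `conductorExponent_ringOfIntegers_eq`).
[cite: SilvermanATAEC1994, Thm. IV.10.2 and IV.11.1] [cite: Saito1988, Theorem 1] -/
theorem padicValNat_conductorNorm_eq_conductorExponentOf (W : WeierstrassCurve ℚ) [W.IsElliptic] (p : ℕ)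
    [Fact p.Prime] (hS : W.swanConductorAt_rationalTate_eq_wildConductorExponent_of_ringChar_eq_two p) {ℓ : ℕ}
    (hℓ : ℓ.Prime) (hℓp : ℓ ≠ p) (w : HeightOneSpectrum (𝓞 ℚ)) (hℓw : (ℓ : 𝓞 ℚ) ∈ w.asIdeal) :
    padicValNat ℓ (W.conductorNorm ℤ) =
      conductorExponentOf (geomPoints W) p (W.continuous_rationalGaloisRepTate_holds p) w := by
  have hpw : (p : 𝓞 ℚ) ∉ w.asIdeal := Rat.natCast_not_mem_of_ne hℓ Fact.out hℓp w hℓw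
  rw [W.artinConductorExponent_tate_eq_conductorExponent_of_isElliptic_of_two p hS _ w hpw]
  have hq : ((primesEquiv w : Nat.Primes) : ℕ) = ℓ := Rat.natGenerator_eq_of_natCast_mem' hℓ w hℓw
  have hgen : natGenerator ((primesEquiv (R := ℤ)).symm (primesEquiv w)) = ℓ := by
    rw [← hq]
    exact congrArg (fun x : Nat.Primes => (x : ℕ)) (Equiv.apply_symm_apply (primesEquiv (R := ℤ)) (primesEquiv w))
  rw [← Nat.factorization_def _ hℓ, W.conductorExponent_ringOfIntegers_eq w,
    ← W.factorization_conductorNorm_holds ((primesEquiv (R := ℤ)).symm (primesEquiv w)), hgen]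

/-- **A framed `ℚ̄_p`-model of `V_p(W)`, modularity-free.**  For an elliptic `W/ℚ` and a prime `p` there is a continuous
`ρ_W : Γ_ℚ →ₜ* GL₂(ℚ̄_p)` such that: (i) at every place `v ∤ p` of good reduction `ρ_W` is unramified with Frobenius
polynomial `X² - a_v(W) X + q_v` (`a_v = W.LFunction q_v`); (ii) at every `w ∤ p` its Artin conductor exponent is
`a_w(V_p W)` (`conductorExponentOf`); (iii) `det ρ_W = 1` on every inertia group at `w ∤ p` (the determinant is the
cyclotomic character, brick LM-E); (iv) `ρ_W(σ) = 1 ↔ V_p(W)(σ) = 1`.  (The tree's framed `ℚ_p`-model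
`exists_framedGaloisRep_rationalTate` base-changed along `ℚ_p → ℚ̄_p`; (ii) by invariance of the conductor under the
frame and under extension of scalars.) [cite: SilvermanAEC2009, C.21 Remark 21.3] [cite: SerreTate1968, §3] -/
theorem exists_framedGaloisRep_padicAlgCl_tate (W : WeierstrassCurve ℚ) [W.IsElliptic] (p : ℕ) [Fact p.Prime] :
    ∃ ρW : FramedGaloisRep ℚ (PadicAlgCl p) 2,
      (∀ v : HeightOneSpectrum (𝓞 ℚ), (p : 𝓞 ℚ) ∉ v.asIdeal → W.HasGoodReductionAt v →
        ρW.IsUnramifiedAt v ∧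
          ρW.HasFrobCharpolyAt v
            (X ^ 2 - C ((W.LFunction (primesEquiv v : ℕ) : ℤ) : PadicAlgCl p) * X +
              C ((primesEquiv v : ℕ) : PadicAlgCl p))) ∧
      (∀ w : HeightOneSpectrum (𝓞 ℚ), (p : 𝓞 ℚ) ∉ w.asIdeal →
        ρW.toGaloisRep.artinConductorExponent w =
          conductorExponentOf (geomPoints W) p (W.continuous_rationalGaloisRepTate_holds p) w) ∧
      (∀ w : HeightOneSpectrum (𝓞 ℚ), (p : 𝓞 ℚ) ∉ w.asIdeal →
        ∀ 𝔓 ∈ w.primesAbove, ∀ σ ∈ 𝔓.inertia (absoluteGaloisGroup ℚ),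
          Matrix.GeneralLinearGroup.det (ρW σ) = 1) ∧
      (∀ σ : absoluteGaloisGroup ℚ, ρW σ = 1 ↔ W.rationalGaloisRepTate p σ = 1) := by
  classical
  obtain ⟨VQ, eV, heV, hV⟩ := exists_framedGaloisRep_rationalTate W p
  set iE := algebraMap ℚ_[p] (PadicAlgCl p) with hiE
  have hiEc : Continuous iE := continuous_algebraMap_padicAlgCl p
  have hcW := W.continuous_rationalGaloisRepTate_holds p
  have heV' : ∀ (g : absoluteGaloisGroup ℚ) (x : Fin 2 → ℚ_[p]),
      eV (VQ.toGaloisRep g x) = rationalTateGaloisRepOf (geomPoints W) p hcW g (eV x) := heV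
  -- `VQ σ` is conjugate to `V_p(W) σ` through `eV`
  have hconj : ∀ σ : absoluteGaloisGroup ℚ,
      (W.rationalGaloisRepTate p σ : W.rationalTateModule p →ₗ[ℚ_[p]] W.rationalTateModule p) =
        (eV : (Fin 2 → ℚ_[p]) →ₗ[ℚ_[p]] W.rationalTateModule p) ∘ₗ VQ.toRepresentation σ ∘ₗ
          (eV.symm : W.rationalTateModule p →ₗ[ℚ_[p]] (Fin 2 → ℚ_[p])) := by
    intro σ
    apply LinearMap.ext
    intro y
    simp only [LinearMap.coe_comp, LinearEquiv.coe_coe, Function.comp_apply]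
    rw [heV, LinearEquiv.apply_symm_apply]
  refine ⟨FramedRep.baseChange iE hiEc VQ, ?_, ?_, ?_, ?_⟩
  · -- (i) unramified with the Frobenius polynomial of `W` at good `v ∤ p`
    intro v hpv hgood
    obtain ⟨hVu, hVf⟩ := hV v hpv hgood
    refine ⟨(FramedGaloisRep.isUnramifiedAt_baseChange_iff iE hiEc iE.injective v VQ).mpr hVu, ?_⟩
    have hVf' := FramedGaloisRep.hasFrobCharpolyAt_baseChange iE hiEc hVf
    have hmapQ : (X ^ 2 - C ((W.LFunction (primesEquiv v : ℕ) : ℤ) : ℚ_[p]) * X +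
        C ((primesEquiv v : ℕ) : ℚ_[p]) : ℚ_[p][X]).map iE =
        X ^ 2 - C ((W.LFunction (primesEquiv v : ℕ) : ℤ) : PadicAlgCl p) * X +
          C ((primesEquiv v : ℕ) : PadicAlgCl p) := by
      simp
    rw [hmapQ] at hVf'
    exact hVf'
  · -- (ii) conductor exponents away from `p`
    intro w _
    rw [FramedGaloisRep.artinConductorExponent_toGaloisRep_baseChange]
    exact GaloisRep.artinConductorExponent_eq_of_equiv VQ.toGaloisRep
      (rationalTateGaloisRepOf (geomPoints W) p hcW) eV heV' w
  · -- (iii) `det = 1` on inertia at `w ∤ p`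
    intro w hpw 𝔓 h𝔓 σ hσ
    have hpw' : ((p : ℕ) : 𝓞 ℚ) ∉ w.asIdeal := hpw
    have hdetQ : Matrix.GeneralLinearGroup.det (VQ σ) = 1 := by
      apply Units.ext
      rw [Matrix.GeneralLinearGroup.val_det_apply, Units.val_one]
      have h1 : ((VQ σ : GL (Fin 2) ℚ_[p]) : Matrix (Fin 2) (Fin 2) ℚ_[p]).det =
          LinearMap.det (VQ.toRepresentation σ) := by
        rw [← LinearMap.det_toLin']
        rfl
      rw [h1]
      have h2 : LinearMap.det (VQ.toRepresentation σ) =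
          LinearMap.det (W.rationalGaloisRepTate p σ : W.rationalTateModule p →ₗ[ℚ_[p]] _) := by
        rw [hconj σ, LinearMap.det_conj]
      rw [h2]
      exact det_rationalGaloisRepTate_eq_one_of_mem_inertia W p hpw' h𝔓 hσ
    apply Units.ext
    rw [Matrix.GeneralLinearGroup.val_det_apply, FramedRep.coe_baseChange_apply, ← RingHom.mapMatrix_apply,
      ← RingHom.map_det, ← Matrix.GeneralLinearGroup.val_det_apply, hdetQ, Units.val_one, map_one, Units.val_one]
  · -- (iv) same kernel as `V_p(W)`
    intro σ
    rw [FramedRep.baseChange_apply_eq_one_iff iE hiEc iE.injective VQ σ]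
    constructor
    · intro h
      apply LinearMap.ext
      intro y
      rw [hconj σ]
      simp only [LinearMap.coe_comp, LinearEquiv.coe_coe, Function.comp_apply, Module.End.one_apply]
      have : VQ.toRepresentation σ = 1 := by
        rw [FramedRep.toRepresentation, MonoidHom.comp_apply]
        change glStdRepresentation (Fin 2) ℚ_[p] (VQ σ) = 1
        rw [h, map_one]
      rw [this, Module.End.one_apply, LinearEquiv.apply_symm_apply]
    · intro h
      -- `VQ σ` acts trivially on `ℚ_p²` since `eV` intertwines with the identity
      have hv : ∀ x : Fin 2 → ℚ_[p], VQ.toRepresentation σ x = x := by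
        intro x
        apply eV.injective
        rw [show VQ.toRepresentation σ x = VQ.toGaloisRep σ x from rfl, heV',
          show rationalTateGaloisRepOf (geomPoints W) p hcW σ (eV x) = W.rationalGaloisRepTate p σ (eV x) from rfl,
          h, Module.End.one_apply]
      have hM : ((VQ σ : GL (Fin 2) ℚ_[p]) : Matrix (Fin 2) (Fin 2) ℚ_[p]) = 1 := by
        apply Matrix.toLin'.injective
        rw [Matrix.toLin'_one]
        apply LinearMap.ext
        intro x
        rw [Matrix.toLin'_apply, LinearMap.id_apply]
        have := hv x
        rwa [FramedRep.toRepresentation_apply_apply] at this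
      exact Units.ext (by rw [hM, Units.val_one])

end Summit.BirchSwinnertonDyer.BirchSwinnertonDyer.Theorems.SmallImageLambdaLowerThreeNsThetaPartner

end
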